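import Summits.ValiantsHypothesis.ValiantsHypothesis.Statement
import Summits.ValiantsHypothesis.ValiantsHypothesis.Theorems.BarrierLeverKRSTNoGoBelow6c
import Literature.Barriers.ValiantsHypothesis.AlgebraicNaturalProofsKRSTVNP

/-!
# Route BarrierLever — the residual band (items `KRSTResidualBandPerSeed` stmt-ValiantsHypothesis-19049,
# `KRSTResidualBandIdeal` stmt-ValiantsHypothesis-19050) is SANDWICHED: `VP = VNP` implies it, and it
# implies (with permanent hardness) the crux — so ANY refutation of the residual band proves `VP ≠ VNP`

Support file for the two D-0059 residual-band items of cell `valiant-natproofs` (rung V4, door (c)):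
"KRST 2022's generator (Kabanets–Impagliazzo over the Reed–Solomon design, base `Perm_[p]`, block
`m = n^{3c}`, `p` the least prime `≥ m² + n + 1`) is per-seed (resp. ideal-) succinct for
`SmallCircuits ℂ n b` for all large `n`, for SOME `c ≥ 1` and SOME `b ≥ 6c`". The band `b < 6c`
is refuted unconditionally (`…KRSTNoGoBelow6c`, item 19093) and `b < 12c` conditionally on
[Bourgain 2005, Thm 2] (item 19340); above `12c` no counting method sees anything. This file does
NOT decide the items. It proves, sorry-free and over the tree's declarations only:

* `uniform_pow_bound_of_isPComputable` — UNIFORMISATION OVER SEEDS (a p-family diagonalisation,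
  the device of the route's `LevelCollapse`, no completeness of the permanent): if for EVERY choice
  of one seed per `n` the diagonal family `n ↦ T n (Y n)` is p-computable, then ONE exponent `b`
  bounds `L(T n y) ≤ n^b` for all large `n` and ALL seeds `y` (pick per `n` a seed bad at the largest
  bad level `≤ n`, `Nat.findGreatest`).
* `isVNPFamily_of_mem_smallDefinable` — a family with `f n ∈ SmallDefinable ℂ n b` (KRST's `VNP`
  slice) for every `n` is p-definable (`IsVNPFamily`).
* `krstSuccinctInVP_of_VNP_subset_VP` — **`VNP_ℂ ⊆ VP_ℂ ⇒ ∀ c, ∃ b, KRSTSuccinctInVP ℂ c b`**: under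
  `VP = VNP` KRST's generator IS per-seed `VP`-succinct at every hardness exponent `c` (KRST §3.4,
  PROVED in the tree as `krstSuccinctIn_smallDefinable`: every output `Σ_μ Perm_[p](y|_{S_μ}) x^μ`
  lies in `SmallDefinable ℂ n (15(6c+3))`; then uniformisation). With the tree's
  `le_of_KRSTSuccinctInVP` the exponent is automatically `≥ 6c`.
* `krstResidualBandPerSeed_of_VNP_subset_VP`, `krstResidualBandIdeal_of_VNP_subset_VP` — hence
  `VNP_ℂ ⊆ VP_ℂ` implies the signatures of items 19049 and 19050 VERBATIM; and the contrapositives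
  `valiantsHypothesis_of_not_krstResidualBandPerSeed`, `valiantsHypothesis_of_not_krstResidualBandIdeal`:
  **a refutation of either residual-band item (for all `c ≥ 1`, `b ≥ 6c`) is a proof of
  `ValiantsHypothesis` (`VP_ℂ ≠ VNP_ℂ`).** This is the formal reason the cell's refutation programme
  for KRST's generator can only ever close BANDS `b < κ·c` (6c kernel, 12c on [B05]) and never the
  whole residual band: closing it unconditionally is at least as hard as Valiant's hypothesis.
* `krstResidualBandIdeal_of_perSeed` — per-seed ⇒ ideal (19049 ⇒ 19050; tree
  `KRSTEdge.IsSuccinctGenerator.ideal`); `krstSuccinctInVP_iff`, `krstResidualBandPerSeed_iff` — the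
  item's shape IS the Literature/KRSTDoor hypothesis `KRSTSuccinctInVP ℂ c b` (eventual forms), and
  the band clause `6c ≤ b` of the item is automatic (`le_of_KRSTSuccinctInVP`);
  `valiantsHypothesis_of_forall_not_krstSuccinctInVP` — the per-exponent meta-barrier: for any FIXED
  `c`, refuting `KRSTSuccinctInVP ℂ c b` for every `b` proves `ValiantsHypothesis`;
  `valiantsHypothesis_of_forall_not_idealSuccinct` — the same in the ideal grade, i.e. in the exact
  shape of the band theorems `krstNoGoBelow6c` (19093) / `krstNoGoBelow12cOnB05` (19340): extending
  either band from `b < κ·c` to all `b` at one fixed `c` proves `VP_ℂ ≠ VNP_ℂ`.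
* `succinctHittingSetsForVP_of_krstResidualBandPerSeed` — the other side of the sandwich (KRST's
  door, tree `KRSTDoor.succinctHittingSetsForVP_of_permanentExpHard`): item 19049 together with
  exponential hardness of the permanent at every exponent `c ≥ 1` gives the crux
  `SuccinctHittingSetsForVP ℂ` (FSV Question 6 for `VP`, item stmt-ValiantsHypothesis-14610).

WHAT THIS IS NOT: not a proof or refutation of 19049 / 19050 (open as filed for `b ≥ 12c`); nothing
on the crux 14610 / FSV Question 6 itself; `ValiantsHypothesis` occurs only as the CONCLUSION of a
contrapositive (no claim of progress on `VP ≠ VNP`); the `VP` barrier stays conditional (D-0053).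

References: [KumarRamyaSaptharishiTengse2022] §3.4–3.5, §4 (open problem 1);
[ForbesShpilkaVolk2018] Def. 7, Question 6; [Burgisser2000] Ch. 2 (p-families, `VP`, `VNP`).
-/

-- layout Summits/ValiantsHypothesis/ValiantsHypothesis forces the duplicated namespace component
set_option linter.dupNamespace false

noncomputable section

namespace Summit.ValiantsHypothesis.ValiantsHypothesis.Theorems.BarrierLever

namespace KRSTResidualBand

open Literature.Barriers.ValiantsHypothesis Literature.Computability.AlgebraicComplexity
  Literature.Computability.MetaComplexity MvPolynomial
open Summit.ValiantsHypothesis.ValiantsHypothesis.Theorems.BarrierLever.SuccinctHittingSetsForVP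
  KRSTEdge KRSTDoor

/-! ### 1. Uniformisation over seeds (p-family diagonalisation) -/

/-- **Uniformisation over seeds.** Let `T n : S n → ℂ[x₁,…,xₙ]` be a seed-indexed family of
polynomials (`S n` nonempty). If for EVERY choice function `Y` (one seed per `n`) the diagonal
family `n ↦ T n (Y n)` is p-computable (`L ≤ n^c + c` for some `c = c(Y)`), then there is ONE
exponent `b` with `L(T n y) ≤ n^b` for all large `n` and ALL seeds `y`. Proof: otherwise pick, for
each `n`, a seed that beats `n^k` for the largest level `k ≤ n` at which some seed does
(`Nat.findGreatest`); the resulting diagonal family has exponent `c`, yet level `c + 2` is beaten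
at some `n ≥ c + 2` — contradiction. (The device of the route's support `LevelCollapse`; no
`VNP`-completeness of the permanent is involved.) -/
theorem uniform_pow_bound_of_isPComputable {S : ℕ → Type*} [∀ n, Nonempty (S n)]
    (T : ∀ n, S n → MvPolynomial (Fin n) ℂ)
    (hT : ∀ Y : (∀ n, S n), IsPComputable (fun n => T n (Y n))) :
    ∃ b n₀ : ℕ, ∀ n : ℕ, n₀ ≤ n → ∀ y : S n, complexity (T n y) ≤ n ^ b := by
  classical
  by_contra hcon
  push Not at hcon
  -- per `n`, a seed that is bad at every level `k ≤ n` at which some seed is bad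
  have key : ∀ n, ∃ y : S n, 0 < n → ∀ k, k ≤ n →
      (∃ y' : S n, n ^ k < complexity (T n y')) → n ^ k < complexity (T n y) := by
    intro n
    by_cases hex : 0 < n ∧ ∃ k, k ≤ n ∧ ∃ y' : S n, n ^ k < complexity (T n y')
    · obtain ⟨hn, k₀, hk₀, hbad₀⟩ := hex
      obtain ⟨y, hy⟩ := Nat.findGreatest_spec
        (P := fun k => ∃ y' : S n, n ^ k < complexity (T n y')) hk₀ hbad₀
      exact ⟨y, fun _ k hk hbad => lt_of_le_of_lt (Nat.pow_le_pow_right hn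
        (Nat.le_findGreatest (P := fun k => ∃ y' : S n, n ^ k < complexity (T n y')) hk hbad)) hy⟩
    · exact ⟨Classical.arbitrary _, fun hn k hk hbad => absurd ⟨hn, k, hk, hbad⟩ hex⟩
  choose Y hY using key
  obtain ⟨c, hc⟩ := hT Y
  obtain ⟨n, hn, y, hy⟩ := hcon (c + 2) (c + 2)
  have hlt : n ^ (c + 2) < complexity (T n (Y n)) := hY n (by omega) (c + 2) hn ⟨y, hy⟩
  have hle : complexity (T n (Y n)) ≤ n ^ c + c := hc n
  have h2 : 2 ≤ n := by omega
  have hcc : c < n ^ c := lt_of_lt_of_le Nat.lt_two_pow_self (Nat.pow_le_pow_left h2 c)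
  have hgrow : n ^ c + c < n ^ (c + 2) :=
    calc n ^ c + c < n ^ c + n ^ c := Nat.add_lt_add_left hcc _
      _ = 2 * n ^ c := by ring
      _ ≤ n ^ 2 * n ^ c := Nat.mul_le_mul_right _ (by nlinarith)
      _ = n ^ (c + 2) := by ring
  exact lt_asymm hgrow (lt_of_lt_of_le hlt hle)

/-! ### 2. `SmallDefinable` families are p-definable -/

/-- `0 ∈ SmallDefinable ℂ n b` (the empty Boolean sum of the zero polynomial; `L(0) = 0`).
[cite: KumarRamyaSaptharishiTengse2022, Def. 3] -/
theorem zero_mem_smallDefinable (n b : ℕ) : (0 : MvPolynomial (Fin n) ℂ) ∈ SmallDefinable ℂ n b := by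
  refine ⟨by simp, 0, Nat.zero_le _, 0, ?_, by simp, by simp [boolSum]⟩
  rw [← C_0]
  exact (complexity_C_holds (0 : ℂ)).trans_le (Nat.zero_le _)

/-- A family with `f n ∈ SmallDefinable ℂ n b` for every `n` (degree `≤ n`, a Boolean sum of a
polynomial `g n` in `n + u` variables with `u, L(g n), deg (g n) ≤ n^b`) is p-definable in the
sense of Bürgisser's `IsVNPFamily` (witness family `g`, p-bounds `n + n^b ≤ 2(n+1)^{b+1}`,
`n^b ≤ (n+1)^b`). [cite: Burgisser2000, Def. 2.5] -/
theorem isVNPFamily_of_mem_smallDefinable {b : ℕ} {f : ∀ n, MvPolynomial (Fin n) ℂ}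
    (hf : ∀ n, f n ∈ SmallDefinable ℂ n b) : IsVNPFamily f := by
  have hf' : ∀ n, ∃ (u : ℕ) (g : MvPolynomial (Fin n ⊕ Fin u) ℂ), (f n).totalDegree ≤ n ∧
      u ≤ n ^ b ∧ complexity g ≤ n ^ b ∧ g.totalDegree ≤ n ^ b ∧ f n = boolSum g := by
    intro n
    obtain ⟨hd, u, hu, g, hgc, hgd, he⟩ := hf n
    exact ⟨u, g, hd, hu, hgc, hgd, he⟩
  choose u g hdeg hu hgc hgd hfg using hf'
  have pb : ∀ (t : ℕ → ℕ) (A B : ℕ), (∀ n, t n ≤ A * (n + 1) ^ B) → IsPBounded t :=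
    fun t A B h => (IsPBounded.iff_exists_le_mul_succ_pow t).2 ⟨A, B, h⟩
  have hpow : ∀ n, n ^ b ≤ (n + 1) ^ b := fun n => Nat.pow_le_pow_left (Nat.le_succ n) b
  have hmo : ∀ n i j, i ≤ j → (n + 1) ^ i ≤ (n + 1) ^ j := fun n i j h =>
    Nat.pow_le_pow_right (Nat.succ_pos n) h
  refine ⟨⟨pb _ 1 1 fun n => by simp, pb _ 1 1 fun n => ?_⟩, u, g,
    ⟨⟨pb _ 2 (b + 1) fun n => ?_, pb _ 1 b fun n => ?_⟩, pb _ 1 b fun n => ?_⟩, hfg⟩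
  · rw [one_mul, pow_one]
    exact (hdeg n).trans (Nat.le_succ n)
  · rw [Fintype.card_sum, Fintype.card_fin, Fintype.card_fin]
    have h1 : n ≤ (n + 1) ^ (b + 1) :=
      calc n ≤ (n + 1) ^ 1 := by rw [pow_one]; exact Nat.le_succ n
        _ ≤ (n + 1) ^ (b + 1) := hmo n 1 (b + 1) (by omega)
    have h2 : u n ≤ (n + 1) ^ (b + 1) :=
      ((hu n).trans (hpow n)).trans (hmo n b (b + 1) (Nat.le_succ b))
    calc n + u n ≤ (n + 1) ^ (b + 1) + (n + 1) ^ (b + 1) := Nat.add_le_add h1 h2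
      _ = 2 * (n + 1) ^ (b + 1) := by ring
  · rw [one_mul]; exact (hgd n).trans (hpow n)
  · rw [one_mul]; exact (hgc n).trans (hpow n)

/-! ### 3. `VP = VNP` ⇒ KRST's generator is per-seed `VP`-succinct at every exponent `c` -/

/-- **`VNP_ℂ ⊆ VP_ℂ` ⇒ `KRSTSuccinctInVP ℂ c b` for some `b`, for EVERY `c`.** KRST §3.4 (tree:
`krstSuccinctIn_smallDefinable`) puts every output `Σ_{|μ| ≤ n} Perm_[p](y|_{S_μ}) x^μ` of KRST's
generator (`p = krstPrime c n`, block `n^{3c}`) into `SmallDefinable ℂ n b₁`, `b₁ = 15(6c+3)`,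
`n ≥ 3`; every diagonal family (one seed per `n`; `0` below `n = 3`) is then p-definable
(`isVNPFamily_of_mem_smallDefinable`), hence p-computable under `VNP ⊆ VP`
(`mem_VNP_ofFintype_iff_holds`, `mem_VP_ofFintype_iff_holds`), and uniformisation
(`uniform_pow_bound_of_isPComputable`) yields one exponent `b` for all seeds.
[cite: KumarRamyaSaptharishiTengse2022, §3.4 and §4] -/
theorem krstSuccinctInVP_of_VNP_subset_VP (hV : VNP ℂ ⊆ VP ℂ) (c : ℕ) :
    ∃ b : ℕ, KRSTSuccinctInVP ℂ c b := by
  classical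
  obtain ⟨b₁, n₁, hsd⟩ := krstSuccinctIn_smallDefinable (F := ℂ) c
  have hT : ∀ (n : ℕ) (y : ZMod (krstPrime c n) × ZMod (krstPrime c n) → ℂ),
      ∃ g : MvPolynomial (Fin n) ℂ, g ∈ SmallDefinable ℂ n b₁ ∧
        (n₁ ≤ n → ∀ μ : degLEMonomials n, coeff (μ : Fin n →₀ ℕ) g =
          eval (y ∘ krstDesign (krstPrime c n) n μ) (perPad ℂ (krstBlock_sq_le_krstPrime c n))) := by
    intro n y
    by_cases hn : n₁ ≤ n
    · obtain ⟨g, hg, hcoeff⟩ := hsd n hn y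
      exact ⟨g, hg, fun _ => hcoeff⟩
    · exact ⟨0, zero_mem_smallDefinable n b₁, fun h => absurd h hn⟩
  choose T hTmem hTcoeff using hT
  have hdiag : ∀ Y : (∀ n : ℕ, ZMod (krstPrime c n) × ZMod (krstPrime c n) → ℂ),
      IsPComputable (fun n => T n (Y n)) := by
    intro Y
    have hVNP : IsVNPFamily (fun n => T n (Y n)) :=
      isVNPFamily_of_mem_smallDefinable fun n => hTmem n (Y n)
    have hmem := (mem_VNP_ofFintype_iff_holds _).2 hVNP
    exact ((mem_VP_ofFintype_iff_holds _).1 (hV hmem)).2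
  obtain ⟨b, n₀, hb⟩ := uniform_pow_bound_of_isPComputable T hdiag
  refine ⟨b, max n₀ n₁, fun n hn y => ⟨T n y, ?_, hTcoeff n y ((le_max_right _ _).trans hn)⟩⟩
  have hmem : (T n y).totalDegree ≤ n ∧ ∃ u : ℕ, u ≤ n ^ b₁ ∧
      ∃ g : MvPolynomial (Fin n ⊕ Fin u) ℂ, complexity g ≤ n ^ b₁ ∧ g.totalDegree ≤ n ^ b₁ ∧
        T n y = boolSum g := hTmem n y
  exact ⟨hmem.1, hb n ((le_max_left _ _).trans hn) y⟩

/-- The same with the band inequality displayed: under `VNP_ℂ ⊆ VP_ℂ`, for every `c` there is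
`b ≥ 6c` with `KRSTSuccinctInVP ℂ c b` (the exponent produced is `≥ 6c` by the unconditional no-go
`le_of_KRSTSuccinctInVP`, item 19093). [cite: KumarRamyaSaptharishiTengse2022, §4] -/
theorem exists_band_krstSuccinctInVP_of_VNP_subset_VP (hV : VNP ℂ ⊆ VP ℂ) (c : ℕ) :
    ∃ b : ℕ, 6 * c ≤ b ∧ KRSTSuccinctInVP ℂ c b := by
  obtain ⟨b, hb⟩ := krstSuccinctInVP_of_VNP_subset_VP hV c
  exact ⟨b, le_of_KRSTSuccinctInVP hb, hb⟩

/-! ### 4. The items' shape: `KRSTSuccinctIn` versus `IsSuccinctGenerator … krstGen` -/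

/-- Conversion (fixed parameters): the `KRSTSuccinctIn`-shaped statement "every seed's output is the
coefficient vector of a member of `SmallCircuits ℂ n b`" IS per-seed succinctness of
`KRSTEdge.krstGen ℂ p n hmp` (`genOutput` of a design generator is `f(y ∘ S_μ)`).
[cite: ForbesShpilkaVolk2018, Def. 7] -/
theorem isSuccinctGenerator_krstGen_of_succinctIn {p n m b : ℕ} [Fact p.Prime] (hmp : m * m ≤ p)
    (h : ∀ y : ZMod p × ZMod p → ℂ, ∃ g ∈ SmallCircuits ℂ n b, ∀ μ : degLEMonomials n,
      coeff (μ : Fin n →₀ ℕ) g = eval (y ∘ krstDesign p n μ) (perPad ℂ hmp)) :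
    IsSuccinctGenerator (degLEMonomials n) (SmallCircuits ℂ n b) (krstGen ℂ p n hmp) := by
  intro y
  obtain ⟨g, hg, hcoeff⟩ := h y
  refine ⟨g, hg, funext fun μ => ?_⟩
  rw [coeffVector_apply, hcoeff μ, genOutput, krstGen, designGenerator, eval_rename]

/-- Conversion, converse direction (fixed parameters). [cite: ForbesShpilkaVolk2018, Def. 7] -/
theorem succinctIn_of_isSuccinctGenerator_krstGen {p n m b : ℕ} [Fact p.Prime] (hmp : m * m ≤ p)
    (h : IsSuccinctGenerator (degLEMonomials n) (SmallCircuits ℂ n b) (krstGen ℂ p n hmp)) :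
    ∀ y : ZMod p × ZMod p → ℂ, ∃ g ∈ SmallCircuits ℂ n b, ∀ μ : degLEMonomials n,
      coeff (μ : Fin n →₀ ℕ) g = eval (y ∘ krstDesign p n μ) (perPad ℂ hmp) := by
  intro y
  obtain ⟨g, hg, hcoeff⟩ := h y
  refine ⟨g, hg, fun μ => ?_⟩
  have hμ := congrFun hcoeff μ
  rw [coeffVector_apply, genOutput, krstGen, designGenerator, eval_rename] at hμ
  exact hμ

/-- **Item shape ↔ Literature/KRSTDoor shape (eventual forms):** `KRSTDoor.KRSTSuccinctInVP ℂ c b`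
(`∃ n₀, ∀ n ≥ n₀, KRSTSuccinctIn ℂ (SmallCircuits ℂ · b) c n`) is literally the `∃ n₀ ∀ n ≥ n₀` body of
the residual-band item at `(c, b)` (`krstPrime c n = leastPrimeGe (n^{3c}·n^{3c} + n + 1)`,
`krstBlock c n = n^{3c}` by `rfl`). [cite: KumarRamyaSaptharishiTengse2022, §4] -/
theorem krstSuccinctInVP_iff (c b : ℕ) : KRSTSuccinctInVP ℂ c b ↔
    ∃ n₀ : ℕ, ∀ n ≥ n₀, Literature.Barriers.ValiantsHypothesis.IsSuccinctGenerator (Literature.Barriers.ValiantsHypothesis.degLEMonomials n) (Literature.Barriers.ValiantsHypothesis.SmallCircuits ℂ n b) (@Summit.ValiantsHypothesis.ValiantsHypothesis.Theorems.BarrierLever.SuccinctHittingSetsForVP.KRSTEdge.krstGen ℂ _ (Literature.Computability.MetaComplexity.leastPrimeGe (n ^ (3 * c) * n ^ (3 * c) + n + 1)) n ⟨(Literature.Computability.MetaComplexity.leastPrimeGe_spec (n ^ (3 * c) * n ^ (3 * c) + n + 1)).2⟩ (n ^ (3 * c)) (le_trans (Nat.le_add_right (n ^ (3 * c) * n ^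 (3 * c)) (n + 1)) (Literature.Computability.MetaComplexity.leastPrimeGe_spec (n ^ (3 * c) * n ^ (3 * c) + n + 1)).1)) := by
  constructor
  · rintro ⟨n₀, hn₀⟩
    refine ⟨n₀, fun n hn => ?_⟩
    haveI : Fact (leastPrimeGe (n ^ (3 * c) * n ^ (3 * c) + n + 1)).Prime :=
      ⟨(leastPrimeGe_spec (n ^ (3 * c) * n ^ (3 * c) + n + 1)).2⟩
    exact isSuccinctGenerator_krstGen_of_succinctIn _ (hn₀ n hn)
  · rintro ⟨n₀, hn₀⟩
    exact ⟨n₀, fun n hn => succinctIn_of_isSuccinctGenerator_krstGen _ (hn₀ n hn)⟩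

/-- Hence item `KRSTResidualBandPerSeed` (19049, verbatim) ↔ `∃ c ≥ 1, ∃ b ≥ 6c, KRSTSuccinctInVP ℂ c b`
↔ (by the unconditional band `le_of_KRSTSuccinctInVP`) `∃ c ≥ 1, ∃ b, KRSTSuccinctInVP ℂ c b`: the
band condition `6c ≤ b` in the item is automatic. [cite: KumarRamyaSaptharishiTengse2022, §4] -/
theorem krstResidualBandPerSeed_iff :
    (∃ c b : ℕ, 1 ≤ c ∧ 6 * c ≤ b ∧ ∃ n₀ : ℕ, ∀ n ≥ n₀, Literature.Barriers.ValiantsHypothesis.IsSuccinctGenerator (Literature.Barriers.ValiantsHypothesis.degLEMonomials n) (Literature.Barriers.ValiantsHypothesis.SmallCircuits ℂ n b) (@Summit.ValiantsHypothesis.ValiantsHypothesis.Theorems.BarrierLever.SuccinctHittingSetsForVP.KRSTEdge.krstGen ℂ _ (Literature.Computability.MetaComplexity.leastPrimeGe (n ^ (3 * c) * n ^ (3 * c) + n + 1)) n ⟨(Literature.Computability.MetaComplexity.leastPrimeGe_spec (n ^ (3 * c) * n ^ (3 * c) + n + 1)).2⟩ (n ^ (3 * c)) (le_trans (Nat.le_add_right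 (n ^ (3 * c) * n ^ (3 * c)) (n + 1)) (Literature.Computability.MetaComplexity.leastPrimeGe_spec (n ^ (3 * c) * n ^ (3 * c) + n + 1)).1))) ↔
      ∃ c b : ℕ, 1 ≤ c ∧ KRSTSuccinctInVP ℂ c b := by
  constructor
  · rintro ⟨c, b, hc, -, h⟩
    exact ⟨c, b, hc, (krstSuccinctInVP_iff c b).2 h⟩
  · rintro ⟨c, b, hc, h⟩
    exact ⟨c, b, hc, le_of_KRSTSuccinctInVP h, (krstSuccinctInVP_iff c b).1 h⟩

/-! ### 5. `VP = VNP` implies both residual-band items; refuting either proves `ValiantsHypothesis` -/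

/-- **`VNP_ℂ ⊆ VP_ℂ` ⇒ item `KRSTResidualBandPerSeed` (stmt-ValiantsHypothesis-19049), signature
VERBATIM** (with `c = 1` and the exponent `b ≥ 6` of `exists_band_krstSuccinctInVP_of_VNP_subset_VP`).
[cite: KumarRamyaSaptharishiTengse2022, §4] -/
theorem krstResidualBandPerSeed_of_VNP_subset_VP (hV : VNP ℂ ⊆ VP ℂ) :
    ∃ c b : ℕ, 1 ≤ c ∧ 6 * c ≤ b ∧ ∃ n₀ : ℕ, ∀ n ≥ n₀, Literature.Barriers.ValiantsHypothesis.IsSuccinctGenerator (Literature.Barriers.ValiantsHypothesis.degLEMonomials n) (Literature.Barriers.ValiantsHypothesis.SmallCircuits ℂ n b) (@Summit.ValiantsHypothesis.ValiantsHypothesis.Theorems.BarrierLever.SuccinctHittingSetsForVP.KRSTEdge.krstGen ℂ _ (Literature.Computability.MetaComplexity.leastPrimeGe (n ^ (3 * c) * n ^ (3 * c) + n + 1)) n ⟨(Literature.Computability.MetaComplexity.leastPrimeGe_spec (n ^ (3 * c) * n ^ (3 * c) + n + 1)).2⟩ (n ^ (3 * c)) (le_trans (Nat.le_add_right (n ^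 (3 * c) * n ^ (3 * c)) (n + 1)) (Literature.Computability.MetaComplexity.leastPrimeGe_spec (n ^ (3 * c) * n ^ (3 * c) + n + 1)).1)) := by
  obtain ⟨b, hb6, n₀, hn₀⟩ := exists_band_krstSuccinctInVP_of_VNP_subset_VP hV 1
  refine ⟨1, b, le_rfl, hb6, n₀, fun n hn => ?_⟩
  haveI : Fact (leastPrimeGe (n ^ (3 * 1) * n ^ (3 * 1) + n + 1)).Prime :=
    ⟨(leastPrimeGe_spec (n ^ (3 * 1) * n ^ (3 * 1) + n + 1)).2⟩
  exact isSuccinctGenerator_krstGen_of_succinctIn _ (hn₀ n hn)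

/-- The per-`c` form: under `VNP_ℂ ⊆ VP_ℂ`, for EVERY `c ≥ 1` KRST's generator with hardness
exponent `c` is eventually per-seed succinct for `SmallCircuits ℂ n b` for some `b ≥ 6c` (item
19049's body with `c` universally quantified). [cite: KumarRamyaSaptharishiTengse2022, §4] -/
theorem krstResidualBandPerSeed_all_of_VNP_subset_VP (hV : VNP ℂ ⊆ VP ℂ) (c : ℕ) :
    ∃ b : ℕ, 6 * c ≤ b ∧ ∃ n₀ : ℕ, ∀ n ≥ n₀, Literature.Barriers.ValiantsHypothesis.IsSuccinctGenerator (Literature.Barriers.ValiantsHypothesis.degLEMonomials n) (Literature.Barriers.ValiantsHypothesis.SmallCircuits ℂ n b) (@Summit.ValiantsHypothesis.ValiantsHypothesis.Theorems.BarrierLever.SuccinctHittingSetsForVP.KRSTEdge.krstGen ℂ _ (Literature.Computability.MetaComplexity.leastPrimeGe (n ^ (3 * c) * n ^ (3 * c) + n + 1)) n ⟨(Literature.Computability.MetaComplexity.leastPrimeGe_spec (n ^ (3 * c) * n ^ (3 * c) + n + 1)).2⟩ (n ^ (3 * c)) (le_trans (Nat.le_add_right (n ^ (3 * c) * n ^ (3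 * c)) (n + 1)) (Literature.Computability.MetaComplexity.leastPrimeGe_spec (n ^ (3 * c) * n ^ (3 * c) + n + 1)).1)) := by
  obtain ⟨b, hb6, n₀, hn₀⟩ := exists_band_krstSuccinctInVP_of_VNP_subset_VP hV c
  refine ⟨b, hb6, n₀, fun n hn => ?_⟩
  haveI : Fact (leastPrimeGe (n ^ (3 * c) * n ^ (3 * c) + n + 1)).Prime :=
    ⟨(leastPrimeGe_spec (n ^ (3 * c) * n ^ (3 * c) + n + 1)).2⟩
  exact isSuccinctGenerator_krstGen_of_succinctIn _ (hn₀ n hn)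

/-- **Per-seed ⇒ ideal: item 19049 implies item 19050** (signatures verbatim; tree
`KRSTEdge.IsSuccinctGenerator.ideal`, `ℂ` an infinite field). [cite: ForbesShpilkaVolk2018, Def. 7] -/
theorem krstResidualBandIdeal_of_perSeed
    (h : ∃ c b : ℕ, 1 ≤ c ∧ 6 * c ≤ b ∧ ∃ n₀ : ℕ, ∀ n ≥ n₀, Literature.Barriers.ValiantsHypothesis.IsSuccinctGenerator (Literature.Barriers.ValiantsHypothesis.degLEMonomials n) (Literature.Barriers.ValiantsHypothesis.SmallCircuits ℂ n b) (@Summit.ValiantsHypothesis.ValiantsHypothesis.Theorems.BarrierLever.SuccinctHittingSetsForVP.KRSTEdge.krstGen ℂ _ (Literature.Computability.MetaComplexity.leastPrimeGe (n ^ (3 * c) * n ^ (3 * c) + n + 1)) n ⟨(Literature.Computability.MetaComplexity.leastPrimeGe_spec (n ^ (3 * c) * n ^ (3 * c) + n + 1)).2⟩ (n ^ (3 * c)) (le_trans (Nat.le_add_right (n ^ (3 * c) * n ^ (3 * c)) (n + 1)) (Literature.Computability.MetaComplexity.leastPrimeGe_spec (n ^ (3 * c) * n ^ (3 * c) + n +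 1)).1))) :
    ∃ c b : ℕ, 1 ≤ c ∧ 6 * c ≤ b ∧ ∃ n₀ : ℕ, ∀ n ≥ n₀, Summit.ValiantsHypothesis.ValiantsHypothesis.Theorems.BarrierLever.SuccinctHittingSetsForVP.KRSTEdge.IsIdealSuccinctGenerator (Literature.Barriers.ValiantsHypothesis.degLEMonomials n) (Literature.Barriers.ValiantsHypothesis.SmallCircuits ℂ n b) (@Summit.ValiantsHypothesis.ValiantsHypothesis.Theorems.BarrierLever.SuccinctHittingSetsForVP.KRSTEdge.krstGen ℂ _ (Literature.Computability.MetaComplexity.leastPrimeGe (n ^ (3 * c) * n ^ (3 * c) + n + 1)) n ⟨(Literature.Computability.MetaComplexity.leastPrimeGe_spec (n ^ (3 * c) * n ^ (3 * c) + n + 1)).2⟩ (n ^ (3 * c)) (le_trans (Nat.le_add_right (n ^ (3 * c) * n ^ (3 * c)) (n + 1)) (Literature.Computability.MetaComplexity.leastPrimeGe_spec (n ^ (3 * c) * n ^ (3 * c) + n + 1)).1)) := by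
  obtain ⟨c, b, hc, hb, n₀, hn⟩ := h
  refine ⟨c, b, hc, hb, n₀, fun n hn' => ?_⟩
  haveI : Fact (leastPrimeGe (n ^ (3 * c) * n ^ (3 * c) + n + 1)).Prime :=
    ⟨(leastPrimeGe_spec (n ^ (3 * c) * n ^ (3 * c) + n + 1)).2⟩
  exact KRSTEdge.IsSuccinctGenerator.ideal (hn n hn')

/-- **`VNP_ℂ ⊆ VP_ℂ` ⇒ item `KRSTResidualBandIdeal` (stmt-ValiantsHypothesis-19050), signature
VERBATIM.** [cite: KumarRamyaSaptharishiTengse2022, §4] -/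
theorem krstResidualBandIdeal_of_VNP_subset_VP (hV : VNP ℂ ⊆ VP ℂ) :
    ∃ c b : ℕ, 1 ≤ c ∧ 6 * c ≤ b ∧ ∃ n₀ : ℕ, ∀ n ≥ n₀, Summit.ValiantsHypothesis.ValiantsHypothesis.Theorems.BarrierLever.SuccinctHittingSetsForVP.KRSTEdge.IsIdealSuccinctGenerator (Literature.Barriers.ValiantsHypothesis.degLEMonomials n) (Literature.Barriers.ValiantsHypothesis.SmallCircuits ℂ n b) (@Summit.ValiantsHypothesis.ValiantsHypothesis.Theorems.BarrierLever.SuccinctHittingSetsForVP.KRSTEdge.krstGen ℂ _ (Literature.Computability.MetaComplexity.leastPrimeGe (n ^ (3 * c) * n ^ (3 * c) + n + 1)) n ⟨(Literature.Computability.MetaComplexity.leastPrimeGe_spec (n ^ (3 * c) * n ^ (3 * c) + n + 1)).2⟩ (n ^ (3 * c)) (le_trans (Nat.le_add_right (n ^ (3 * c) * n ^ (3 * c)) (n + 1)) (Literature.Computability.MetaComplexity.leastPrimeGe_spec (n ^ (3 * c) * n ^ (3 * c) + n + 1)).1)) :=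
  krstResidualBandIdeal_of_perSeed (krstResidualBandPerSeed_of_VNP_subset_VP hV)

/-- **Refuting item 19049 proves Valiant's hypothesis**: if KRST's generator is NOT eventually
per-seed `VP_{n,b}`-succinct for any `c ≥ 1`, `b ≥ 6c` (the negation of item
`KRSTResidualBandPerSeed`, verbatim), then `ValiantsHypothesis` (`VP_ℂ ≠ VNP_ℂ`). Contrapositive of
`krstResidualBandPerSeed_of_VNP_subset_VP`. A META-BARRIER for the cell's refutation programme, not
a statement about the truth of either side. [cite: KumarRamyaSaptharishiTengse2022, §4] -/
theorem valiantsHypothesis_of_not_krstResidualBandPerSeed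
    (h : ¬ (∃ c b : ℕ, 1 ≤ c ∧ 6 * c ≤ b ∧ ∃ n₀ : ℕ, ∀ n ≥ n₀, Literature.Barriers.ValiantsHypothesis.IsSuccinctGenerator (Literature.Barriers.ValiantsHypothesis.degLEMonomials n) (Literature.Barriers.ValiantsHypothesis.SmallCircuits ℂ n b) (@Summit.ValiantsHypothesis.ValiantsHypothesis.Theorems.BarrierLever.SuccinctHittingSetsForVP.KRSTEdge.krstGen ℂ _ (Literature.Computability.MetaComplexity.leastPrimeGe (n ^ (3 * c) * n ^ (3 * c) + n + 1)) n ⟨(Literature.Computability.MetaComplexity.leastPrimeGe_spec (n ^ (3 * c) * n ^ (3 * c) + n + 1)).2⟩ (n ^ (3 * c)) (le_trans (Nat.le_add_right (n ^ (3 * c) * n ^ (3 * c)) (n + 1)) (Literature.Computability.MetaComplexity.leastPrimeGe_spec (n ^ (3 * c) * n ^ (3 * c) + n + 1)).1)))) :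
    ValiantsHypothesis := by
  unfold ValiantsHypothesis Literature.PNP.ValiantHypothesis
  intro hEq
  have hV : VNP ℂ ⊆ VP ℂ := fun F hF => by rw [hEq]; exact hF
  exact h (krstResidualBandPerSeed_of_VNP_subset_VP hV)

/-- **Refuting item 19050 proves Valiant's hypothesis** (the ideal grade; the negation of item
`KRSTResidualBandIdeal`, verbatim ⇒ `ValiantsHypothesis`). Since ideal succinctness is the WEAKEST
grade, an unconditional ideal-grade no-go for ALL `b ≥ 6c` — the natural continuation of the bands
`b < 6c` (item 19093) and `b < 12c` on [B05] (item 19340) — would separate `VP_ℂ` from `VNP_ℂ`.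
[cite: KumarRamyaSaptharishiTengse2022, §4] -/
theorem valiantsHypothesis_of_not_krstResidualBandIdeal
    (h : ¬ (∃ c b : ℕ, 1 ≤ c ∧ 6 * c ≤ b ∧ ∃ n₀ : ℕ, ∀ n ≥ n₀, Summit.ValiantsHypothesis.ValiantsHypothesis.Theorems.BarrierLever.SuccinctHittingSetsForVP.KRSTEdge.IsIdealSuccinctGenerator (Literature.Barriers.ValiantsHypothesis.degLEMonomials n) (Literature.Barriers.ValiantsHypothesis.SmallCircuits ℂ n b) (@Summit.ValiantsHypothesis.ValiantsHypothesis.Theorems.BarrierLever.SuccinctHittingSetsForVP.KRSTEdge.krstGen ℂ _ (Literature.Computability.MetaComplexity.leastPrimeGe (n ^ (3 * c) * n ^ (3 * c) + n + 1)) n ⟨(Literature.Computability.MetaComplexity.leastPrimeGe_spec (n ^ (3 * c) * n ^ (3 * c) + n + 1)).2⟩ (n ^ (3 * c)) (le_trans (Nat.le_add_right (n ^ (3 * c) * n ^ (3 * c)) (n + 1)) (Literature.Computability.MetaComplexity.leastPrimeGe_spec (n ^ (3 * c) * n ^ (3 * c) + n + 1)).1)))) :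
    ValiantsHypothesis := by
  unfold ValiantsHypothesis Literature.PNP.ValiantHypothesis
  intro hEq
  have hV : VNP ℂ ⊆ VP ℂ := fun F hF => by rw [hEq]; exact hF
  exact h (krstResidualBandIdeal_of_VNP_subset_VP hV)

/-- **Per-exponent meta-barrier:** for ANY fixed hardness exponent `c`, an unconditional proof that
KRST's generator is not eventually per-seed `VP_{n,b}`-succinct for EVERY `b` (i.e. closing the
whole residual band at that `c`, not just `b < κ·c`) proves `ValiantsHypothesis`. Contrapositive of
`krstSuccinctInVP_of_VNP_subset_VP`. [cite: KumarRamyaSaptharishiTengse2022, §4] -/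
theorem valiantsHypothesis_of_forall_not_krstSuccinctInVP (c : ℕ)
    (h : ∀ b : ℕ, ¬ KRSTSuccinctInVP ℂ c b) : ValiantsHypothesis := by
  unfold ValiantsHypothesis Literature.PNP.ValiantHypothesis
  intro hEq
  have hV : VNP ℂ ⊆ VP ℂ := fun F hF => by rw [hEq]; exact hF
  obtain ⟨b, hb⟩ := krstSuccinctInVP_of_VNP_subset_VP hV c
  exact h b hb

/-- **Per-exponent meta-barrier, ideal grade — in the exact shape of the band theorems
`krstNoGoBelow6c c b` (item 19093) / `krstNoGoBelow12cOnB05` (item 19340):** for ANY fixed `c`,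
extending the no-go `¬ (∃ n₀, ∀ n ≥ n₀, IsIdealSuccinctGenerator … (c, b) …)` from a band `b < κ·c` to
EVERY `b` proves `ValiantsHypothesis` (ideal is weaker than per-seed over `ℂ`:
`KRSTEdge.IsSuccinctGenerator.ideal`). [cite: KumarRamyaSaptharishiTengse2022, §4] -/
theorem valiantsHypothesis_of_forall_not_idealSuccinct (c : ℕ)
    (h : ∀ b : ℕ, ¬ (∃ n₀ : ℕ, ∀ n ≥ n₀, Summit.ValiantsHypothesis.ValiantsHypothesis.Theorems.BarrierLever.SuccinctHittingSetsForVP.KRSTEdge.IsIdealSuccinctGenerator (Literature.Barriers.ValiantsHypothesis.degLEMonomials n) (Literature.Barriers.ValiantsHypothesis.SmallCircuits ℂ n b) (@Summit.ValiantsHypothesis.ValiantsHypothesis.Theorems.BarrierLever.SuccinctHittingSetsForVP.KRSTEdge.krstGen ℂ _ (Literature.Computability.MetaComplexity.leastPrimeGe (n ^ (3 * c) * n ^ (3 * c) + n + 1)) n ⟨(Literature.Computability.MetaComplexity.leastPrimeGe_spec (n ^ (3 * c) * n ^ (3 * c) + n + 1)).2⟩ (n ^ (3 * c)) (le_trans (Nat.le_add_right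 (n ^ (3 * c) * n ^ (3 * c)) (n + 1)) (Literature.Computability.MetaComplexity.leastPrimeGe_spec (n ^ (3 * c) * n ^ (3 * c) + n + 1)).1)))) : ValiantsHypothesis := by
  refine valiantsHypothesis_of_forall_not_krstSuccinctInVP c fun b hb => h b ?_
  obtain ⟨n₀, hn₀⟩ := (krstSuccinctInVP_iff c b).1 hb
  refine ⟨n₀, fun n hn => ?_⟩
  haveI : Fact (leastPrimeGe (n ^ (3 * c) * n ^ (3 * c) + n + 1)).Prime :=
    ⟨(leastPrimeGe_spec (n ^ (3 * c) * n ^ (3 * c) + n + 1)).2⟩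
  exact KRSTEdge.IsSuccinctGenerator.ideal (hn₀ n hn)

/-! ### 6. The other side: item 19049 and permanent hardness give the crux (KRST's door) -/

/-- **Item 19049 ∧ exponential hardness of the permanent ⇒ FSV Question 6 for `VP`** (the crux
`SuccinctHittingSetsForVP ℂ`, item stmt-ValiantsHypothesis-14610): the residual-band item supplies
`KRSTSuccinctInVP ℂ c b` for ITS `c ≥ 1`, so hardness is needed at every `c ≥ 1` (equivalently, by
monotonicity of `L(per_m)`, at `c = 1`); then KRST's argument (tree
`KRSTDoor.succinctHittingSetsForVP_of_permanentExpHard`) concludes. Both hypotheses are open; this is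
the ladder arrow 19049 → 14610 made formal, nothing more.
[cite: KumarRamyaSaptharishiTengse2022, Thm. MainThm and §4] -/
theorem succinctHittingSetsForVP_of_krstResidualBandPerSeed
    (h : ∃ c b : ℕ, 1 ≤ c ∧ 6 * c ≤ b ∧ ∃ n₀ : ℕ, ∀ n ≥ n₀, Literature.Barriers.ValiantsHypothesis.IsSuccinctGenerator (Literature.Barriers.ValiantsHypothesis.degLEMonomials n) (Literature.Barriers.ValiantsHypothesis.SmallCircuits ℂ n b) (@Summit.ValiantsHypothesis.ValiantsHypothesis.Theorems.BarrierLever.SuccinctHittingSetsForVP.KRSTEdge.krstGen ℂ _ (Literature.Computability.MetaComplexity.leastPrimeGe (n ^ (3 * c) * n ^ (3 * c) + n + 1)) n ⟨(Literature.Computability.MetaComplexity.leastPrimeGe_spec (n ^ (3 * c) * n ^ (3 * c) + n + 1)).2⟩ (n ^ (3 * c)) (le_trans (Nat.le_add_right (n ^ (3 * c) * n ^ (3 * c)) (n + 1)) (Literature.Computability.MetaComplexity.leastPrimeGe_spec (n ^ (3 * c) * n ^ (3 * c) + n + 1)).1)))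
    (hper : ∀ c : ℕ, 1 ≤ c → ∃ m₀ : ℕ, PermanentExpHardWith ℂ c m₀) :
    Literature.Barriers.ValiantsHypothesis.SuccinctHittingSetsForVP ℂ := by
  obtain ⟨c, b, hc, -, n₀, hn₀⟩ := h
  obtain ⟨m₀, hm₀⟩ := hper c hc
  refine succinctHittingSetsForVP_of_permanentExpHard hm₀ (b := b) ⟨n₀, fun n hn => ?_⟩
  exact succinctIn_of_isSuccinctGenerator_krstGen _ (hn₀ n hn)

end KRSTResidualBand

end Summit.ValiantsHypothesis.ValiantsHypothesis.Theorems.BarrierLever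

end
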